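import Summits.QuantumFields.YangMills.Theorems.FluctuationComparisonRegPrIntLS2BetaRelativeChainCoupling
import HarnessLib

/-!
# S2β · letter (D♮)∕(D-stage) REL-TEL, the (C)-half — THE ARC-LINEAR CAUCHY LETTERS: `‖J(x′,H′) − J(x,H)‖ ≤ (4M∕R)·‖x′ − x‖ + (16M‖x‖∕R²)·‖H′ − H‖`
# for a coupling junk with `J(0, H) ≡ 0` — the CONTEXT difference `‖H′ − H‖` (pure ARC: relative open transports) is paid with the SIZE `‖x‖` of the background's member
# logarithms, never with the radius (which contains the arc itself); so no `arc²` term survives (self-audit FINDING 14:09Z on ✓p824595's `1.1·10⁷·β²`)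

Cell `ym3-torus` (rung R3 = continuum `SU(2)` Yang–Mills on the three-torus — NOT d = 4, NOT infinite volume, NOT a mass gap, NOT Clay).
Width seat «width 10» `ym3-torus-px10` (gen 23), FREE px helper on crux `stmt-QuantumFields-20520`, count-neutral, DEFINITION-FREE; own-risk brick of the px10 lane
«(C)-half of letter (D♮)» (UV3-NODE §82).  The device of ✓p823094 (`norm_sub_le_on_half_ball`: bounded holomorphic ⟹ Lipschitz, Mathlib's Schwarz lemma) run in TWO
stages on a product `E₁ × E₂`: (i) `y ↦ J(y, k)` on `B(0, R)` is `(4M∕R)`-Lipschitz on the half ball; (ii) hence `‖J(x, k)‖ = ‖J(x, k) − J(0, k)‖ ≤ 4M‖x‖∕R` for EVERY `k` in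
the big ball, so `k ↦ J(x, k)` is `(16M‖x‖∕R²)`-Lipschitz on the half ball.  For the hybrid ×4 junk `J₁₀` (✓G10) and the chain junk `J₁₄` (✓G14) — both `= mlog H − mlog H = 0`
at zero member logarithms — this gives the ARC-LINEAR relative letters: with `x` := the BACKGROUND's member logarithms (size `≤ r₀`, BKG) the context difference costs
`2048(e^{32ρ} − 1)ρ⁻¹·r₀·‖H′ − H‖ ≈ 6.6·10⁴·r₀·‖H′ − H‖`, the member difference `4096(e^{32ρ} − 1)·δ` as in ✓p823094∕✓p823336.
* §1 ★★★ `norm_sub_le_arcLinear` (generic, `E₁ × E₂`), `mean_const`.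
* §2 ★★★ `norm_hybrid4_sub_hybrid4_le_arcLinear`; §3 ★★★ `norm_chain4_sub_chain4_le_arcLinear`.

HONEST SCOPE.  Two calls of ✓p823094's device + differentiability bookkeeping; nothing of Bałaban's renormalisation analysis asserted; the arc-linear relative (C)-step
(FILE 7″), its `hstep`∕`hj` and torus editions, (H♭♭), (D-stage), GAP♯∘ (`stub_uniformFibreGapOrbit`), S2β, crux 20520 and `YM3TorusSU2` are NOT proved; no registered stub is
closed; the Yang–Mills mass gap is NOT proved.  Sorry-free, axioms standard.
References: T. Bałaban, CMP **98** (1985) 17–51 [Balaban1985Averaging] ((21) p.21, (26)–(27) p.22); CMP **109** (1987) 249–301 [Balaban1987RG1] (§3 (3.15)–(3.17) p.273).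
-/

set_option autoImplicit false

noncomputable section

namespace Summit.QuantumFields.YangMills.Theorems.FluctuationComparisonRegPrIntLS2BetaArcLinearCauchy

open NormedSpace Finset Metric
open scoped BigOperators
open Literature.MathematicalPhysics.QuantumFieldTheory.Balaban1983to89.MatrixLog (mlog)
open Summit.QuantumFields.YangMills.Theorems.FluctuationComparisonRegPrIntLS2BetaHybridFourSlot (norm_mlog_word4_sub_mean4_le norm_mean_le)
open Summit.QuantumFields.YangMills.Theorems.FluctuationComparisonRegPrIntLS2BetaSizeLipschitzByCauchy
  (norm_sub_le_on_half_ball differentiableOn_hybrid4 sizes_on_ball_one)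
open Summit.QuantumFields.YangMills.Theorems.FluctuationComparisonRegPrIntLS2BetaRelativeChainCoupling (differentiableOn_chain4 norm_chain4_le_of_sizes)

/-! ## §1 The two-stage device on a product -/

section Device

variable {E₁ E₂ F : Type*} [NormedAddCommGroup E₁] [NormedSpace ℂ E₁] [NormedAddCommGroup E₂] [NormedSpace ℂ E₂]
  [NormedAddCommGroup F] [NormedSpace ℂ F]

/-- ★★★ **ARC-LINEAR LIPSCHITZ BY CAUCHY, TWO STAGES**: `J : E₁ × E₂ → F` complex-differentiable on the sup-ball `B((0, c), R)`, `‖J‖ ≤ M` there, and `J(0, k) = 0` for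
every `k ∈ B(c, R)`.  Then for `x, x′ ∈ B(0, R∕2)` and `k, k′ ∈ B(c, R∕2)`:
`‖J(x′, k′) − J(x, k)‖ ≤ (4M∕R)·‖x′ − x‖ + (16M‖x‖∕R²)·‖k′ − k‖` — the second variable's difference is paid with `‖x‖`, not with `R`.
[cite: Balaban1987RG1, §3 (3.15)-(3.17) p.273] -/
theorem norm_sub_le_arcLinear {J : E₁ × E₂ → F} {c : E₂} {R M : ℝ} (hd : DifferentiableOn ℂ J (ball ((0 : E₁), c) R))
    (hM : ∀ p ∈ ball ((0 : E₁), c) R, ‖J p‖ ≤ M) (h0 : ∀ k ∈ ball c R, J (0, k) = 0)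
    {x x' : E₁} {k k' : E₂} (hx : x ∈ ball (0 : E₁) (R / 2)) (hx' : x' ∈ ball (0 : E₁) (R / 2)) (hk : k ∈ ball c (R / 2))
    (hk' : k' ∈ ball c (R / 2)) :
    ‖J (x', k') - J (x, k)‖ ≤ 4 * M / R * ‖x' - x‖ + 16 * M * ‖x‖ / R ^ 2 * ‖k' - k‖ := by
  have hR : 0 < R := by have h := (nonempty_ball (x := (0 : E₁))).mp ⟨x, hx⟩; linarith
  have hhalf₁ : ball (0 : E₁) (R / 2) ⊆ ball 0 R := ball_subset_ball (by linarith)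
  have hhalf₂ : ball c (R / 2) ⊆ ball c R := ball_subset_ball (by linarith)
  have hM0 : 0 ≤ M := (norm_nonneg _).trans (hM (x, k) (by rw [← ball_prod_same]; exact Set.mk_mem_prod (hhalf₁ hx) (hhalf₂ hk)))
  -- stage 1: the slices `y ↦ J (y, q)`, `q` anywhere in the big ball
  have stage1 : ∀ q ∈ ball c R, ∀ y₁ ∈ ball (0 : E₁) (R / 2), ∀ y₂ ∈ ball (0 : E₁) (R / 2), ‖J (y₁, q) - J (y₂, q)‖ ≤ 4 * M / R * ‖y₁ - y₂‖ := by
    intro q hq y₁ hy₁ y₂ hy₂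
    have hmaps : Set.MapsTo (fun y : E₁ => (y, q)) (ball (0 : E₁) R) (ball ((0 : E₁), c) R) := fun y hy => by
      rw [← ball_prod_same]; exact Set.mk_mem_prod hy hq
    have hd₁ : DifferentiableOn ℂ (fun y : E₁ => J (y, q)) (ball (0 : E₁) R) :=
      hd.comp (differentiableOn_id.prodMk (differentiableOn_const q)) hmaps
    exact norm_sub_le_on_half_ball hd₁ (fun y hy => hM _ (hmaps hy)) hy₁ hy₂
  -- stage 2: the slice `q ↦ J (x, q)` has sup `≤ 4M‖x‖∕R` on the big ball (stage 1 against `y₂ = 0`, `J (0, q) = 0`)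
  have h0mem : (0 : E₁) ∈ ball (0 : E₁) (R / 2) := mem_ball_self (by linarith)
  have hsup : ∀ q ∈ ball c R, ‖J (x, q)‖ ≤ 4 * M / R * ‖x‖ := fun q hq => by
    have h := stage1 q hq x hx 0 h0mem
    rwa [h0 q hq, sub_zero, sub_zero] at h
  have hmaps₂ : Set.MapsTo (fun q : E₂ => (x, q)) (ball c R) (ball ((0 : E₁), c) R) := fun q hq => by
    rw [← ball_prod_same]; exact Set.mk_mem_prod (hhalf₁ hx) hq
  have hd₂ : DifferentiableOn ℂ (fun q : E₂ => J (x, q)) (ball c R) :=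
    hd.comp ((differentiableOn_const x).prodMk differentiableOn_id) hmaps₂
  have stage2 := norm_sub_le_on_half_ball hd₂ hsup hk' hk
  -- combine
  have e : 4 * (4 * M / R * ‖x‖) / R = 16 * M * ‖x‖ / R ^ 2 := by field_simp; ring
  rw [e] at stage2
  calc ‖J (x', k') - J (x, k)‖ = ‖(J (x', k') - J (x, k')) + (J (x, k') - J (x, k))‖ := by rw [sub_add_sub_cancel]
    _ ≤ ‖J (x', k') - J (x, k')‖ + ‖J (x, k') - J (x, k)‖ := norm_add_le _ _
    _ ≤ 4 * M / R * ‖x' - x‖ + 16 * M * ‖x‖ / R ^ 2 * ‖k' - k‖ := add_le_add (stage1 k' (hhalf₂ hk') x' hx' x hx) stage2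

end Device

/-! ## §2 The hybrid ×4 junk: `J₁₀(0, H) = 0` and the arc-linear letter -/

section Hybrid

variable {𝔸 : Type*} [NormedRing 𝔸] [NormedAlgebra ℂ 𝔸] [CompleteSpace 𝔸] [NormOneClass 𝔸]
variable {ι : Type*} [Fintype ι] [Nonempty ι]

omit [CompleteSpace 𝔸] [NormOneClass 𝔸] in
/-- The mean of a constant family is the constant. [folklore] -/
theorem mean_const (x : 𝔸) : ((Fintype.card ι : ℝ))⁻¹ • ∑ _i : ι, x = x := by
  have hc : (Fintype.card ι : ℝ) ≠ 0 := Nat.cast_ne_zero.mpr Fintype.card_ne_zero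
  rw [Finset.sum_const, Finset.card_univ, ← Nat.cast_smul_eq_nsmul ℝ, smul_smul, inv_mul_cancel₀ hc, one_smul]

/-- ★★★ **THE ARC-LINEAR RELATIVE HYBRID ×4 LETTER**: as ✓p823094 `norm_hybrid4_sub_hybrid4_le` (two member tuples of size `≤ ρ`, contexts `‖H − 1‖, ‖H′ − 1‖ ≤ e^ρ − 1`,
`0 < ρ ≤ 1∕800`, member differences `≤ δ`) but with the CONTEXT difference `‖H′ − H‖ ≤ δ_H` priced SEPARATELY by the size `r₀` of the UNPRIMED tuple:
`‖J₁₀(a′,b′,c′,d′,H′) − J₁₀(a,b,c,d,H)‖ ≤ 4096(e^{32ρ} − 1)·δ + 2048(e^{32ρ} − 1)ρ⁻¹·r₀·δ_H` (`J₁₀(0,0,0,0,·) ≡ 0`: both terms equal `mlog H`).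
[cite: Balaban1985Averaging, (21) p.21] -/
theorem norm_hybrid4_sub_hybrid4_le_arcLinear (a b c d a' b' c' d' : ι → 𝔸) (H H' : 𝔸) {ρ r₀ δ δH : ℝ} (hρ0 : 0 < ρ) (hρ : ρ ≤ 1 / 800)
    (ha : ∀ i, ‖a i‖ ≤ ρ) (hb : ∀ i, ‖b i‖ ≤ ρ) (hc : ∀ i, ‖c i‖ ≤ ρ) (hd : ∀ i, ‖d i‖ ≤ ρ) (hH : ‖H - 1‖ ≤ Real.exp ρ - 1)
    (ha' : ∀ i, ‖a' i‖ ≤ ρ) (hb' : ∀ i, ‖b' i‖ ≤ ρ) (hc' : ∀ i, ‖c' i‖ ≤ ρ) (hd' : ∀ i, ‖d' i‖ ≤ ρ) (hH' : ‖H' - 1‖ ≤ Real.exp ρ - 1)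
    (hr₀ : 0 ≤ r₀) (hra : ∀ i, ‖a i‖ ≤ r₀) (hrb : ∀ i, ‖b i‖ ≤ r₀) (hrc : ∀ i, ‖c i‖ ≤ r₀) (hrd : ∀ i, ‖d i‖ ≤ r₀)
    (hδ0 : 0 ≤ δ) (hda : ∀ i, ‖a' i - a i‖ ≤ δ) (hdb : ∀ i, ‖b' i - b i‖ ≤ δ) (hdc : ∀ i, ‖c' i - c i‖ ≤ δ) (hdd : ∀ i, ‖d' i - d i‖ ≤ δ)
    (hdH : ‖H' - H‖ ≤ δH) :
    ‖(mlog (exp (((Fintype.card ι : ℝ))⁻¹ • ∑ i, a' i) * exp (((Fintype.card ι : ℝ))⁻¹ • ∑ i, b' i) *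
          exp (((Fintype.card ι : ℝ))⁻¹ • ∑ i, c' i) * exp (((Fintype.card ι : ℝ))⁻¹ • ∑ i, d' i) * H') -
        ((Fintype.card ι : ℝ))⁻¹ • ∑ i, ((Fintype.card ι : ℝ))⁻¹ • ∑ j, ((Fintype.card ι : ℝ))⁻¹ • ∑ k, ((Fintype.card ι : ℝ))⁻¹ • ∑ l,
          mlog (exp (a' i) * exp (b' j) * exp (c' k) * exp (d' l) * H')) -
      (mlog (exp (((Fintype.card ι : ℝ))⁻¹ • ∑ i, a i) * exp (((Fintype.card ι : ℝ))⁻¹ • ∑ i, b i) *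
          exp (((Fintype.card ι : ℝ))⁻¹ • ∑ i, c i) * exp (((Fintype.card ι : ℝ))⁻¹ • ∑ i, d i) * H) -
        ((Fintype.card ι : ℝ))⁻¹ • ∑ i, ((Fintype.card ι : ℝ))⁻¹ • ∑ j, ((Fintype.card ι : ℝ))⁻¹ • ∑ k, ((Fintype.card ι : ℝ))⁻¹ • ∑ l,
          mlog (exp (a i) * exp (b j) * exp (c k) * exp (d l) * H))‖ ≤
      4096 * (Real.exp (32 * ρ) - 1) * δ + 2048 * (Real.exp (32 * ρ) - 1) / ρ * r₀ * δH := by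
  -- ✓G10's map `G` on the nested tuple space `E`, and the re-association `φ : X × 𝔸 → E` (`X = (ι → 𝔸)⁴`)
  set G : ((ι → 𝔸) × (ι → 𝔸) × (ι → 𝔸) × (ι → 𝔸) × 𝔸) → 𝔸 := fun p =>
      mlog (exp (((Fintype.card ι : ℝ))⁻¹ • ∑ i, p.1 i) * exp (((Fintype.card ι : ℝ))⁻¹ • ∑ i, p.2.1 i) *
          exp (((Fintype.card ι : ℝ))⁻¹ • ∑ i, p.2.2.1 i) * exp (((Fintype.card ι : ℝ))⁻¹ • ∑ i, p.2.2.2.1 i) * p.2.2.2.2) -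
        ((Fintype.card ι : ℝ))⁻¹ • ∑ i, ((Fintype.card ι : ℝ))⁻¹ • ∑ j, ((Fintype.card ι : ℝ))⁻¹ • ∑ k, ((Fintype.card ι : ℝ))⁻¹ • ∑ l,
          mlog (exp (p.1 i) * exp (p.2.1 j) * exp (p.2.2.1 k) * exp (p.2.2.2.1 l) * p.2.2.2.2) with hGdef
  set φ : (((ι → 𝔸) × (ι → 𝔸) × (ι → 𝔸) × (ι → 𝔸)) × 𝔸) → ((ι → 𝔸) × (ι → 𝔸) × (ι → 𝔸) × (ι → 𝔸) × 𝔸) :=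
    fun q => (q.1.1, q.1.2.1, q.1.2.2.1, q.1.2.2.2, q.2) with hφ
  have hφd : Differentiable ℂ φ :=
    (differentiable_fst.comp differentiable_fst).prodMk ((differentiable_fst.comp (differentiable_snd.comp differentiable_fst)).prodMk
      ((differentiable_fst.comp (differentiable_snd.comp (differentiable_snd.comp differentiable_fst))).prodMk
        ((differentiable_snd.comp (differentiable_snd.comp (differentiable_snd.comp differentiable_fst))).prodMk differentiable_snd)))
  have hφmaps : ∀ {R : ℝ}, Set.MapsTo φ (ball (((0 : (ι → 𝔸) × (ι → 𝔸) × (ι → 𝔸) × (ι → 𝔸))), (1 : 𝔸)) R)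
      (ball ((0, 0, 0, 0, 1) : (ι → 𝔸) × (ι → 𝔸) × (ι → 𝔸) × (ι → 𝔸) × 𝔸) R) := fun {R} q hq => by
    simp only [hφ, mem_ball, Prod.dist_eq, Prod.fst_zero, Prod.snd_zero, max_lt_iff] at hq ⊢
    exact ⟨hq.1.1, hq.1.2.1, hq.1.2.2.1, hq.1.2.2.2, hq.2⟩
  have hρ1 : ρ ≤ 1 := by linarith
  -- differentiability and the absolute bound on the big ball (radius `8ρ`), as in ✓p823094
  have h0 : ∀ i, ‖(0 : ι → 𝔸) i‖ ≤ 0 := fun i => by simp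
  have hdiffE : DifferentiableOn ℂ G (ball ((0, 0, 0, 0, 1) : (ι → 𝔸) × (ι → 𝔸) × (ι → 𝔸) × (ι → 𝔸) × 𝔸) (8 * ρ)) :=
    differentiableOn_hybrid4 (p₀ := ((0, 0, 0, 0, 1) : (ι → 𝔸) × (ι → 𝔸) × (ι → 𝔸) × (ι → 𝔸) × 𝔸)) (ρ := 0) (r := 8 * ρ)
      (by linarith) (by linarith) h0 h0 h0 h0 (by simp)
  have hdiff := hdiffE.comp hφd.differentiableOn (hφmaps (R := 8 * ρ))
  have hM : ∀ q ∈ ball (((0 : (ι → 𝔸) × (ι → 𝔸) × (ι → 𝔸) × (ι → 𝔸))), (1 : 𝔸)) (8 * ρ),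
      ‖(G ∘ φ) q‖ ≤ 64 * (2 * (Real.exp (4 * (8 * ρ)) - 1)) * (64 * ρ) := by
    intro q hq
    obtain ⟨ha₈, hb₈, hc₈, hd₈, hH₈⟩ := sizes_on_ball_one (hφmaps hq)
    have hG := norm_mlog_word4_sub_mean4_le (φ q).1 (φ q).2.1 (φ q).2.2.1 (φ q).2.2.2.1 (φ q).2.2.2.2 (ρ := 8 * ρ) (by linarith) ha₈ hb₈ hc₈ hd₈ hH₈
    rw [Function.comp_apply]
    refine hG.trans (mul_le_mul_of_nonneg_left ?_ (by
      have : 0 ≤ Real.exp (4 * (8 * ρ)) - 1 := by linarith [Real.add_one_le_exp (4 * (8 * ρ))]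
      positivity))
    have fl : ∀ (f : ι → 𝔸), (∀ i, ‖f i‖ ≤ 8 * ρ) → ((Fintype.card ι : ℝ))⁻¹ * ∑ i, ‖f i - ((Fintype.card ι : ℝ))⁻¹ • ∑ j, f j‖ ≤ 16 * ρ := by
      intro f hf
      have hc0 : (0 : ℝ) < Fintype.card ι := Nat.cast_pos.mpr Fintype.card_pos
      have hterm : ∀ i, ‖f i - ((Fintype.card ι : ℝ))⁻¹ • ∑ j, f j‖ ≤ 16 * ρ := fun i =>
        (norm_sub_le _ _).trans (by linarith [hf i, norm_mean_le f hf])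
      calc ((Fintype.card ι : ℝ))⁻¹ * ∑ i, ‖f i - ((Fintype.card ι : ℝ))⁻¹ • ∑ j, f j‖ ≤ ((Fintype.card ι : ℝ))⁻¹ * ∑ _i : ι, 16 * ρ :=
          mul_le_mul_of_nonneg_left (Finset.sum_le_sum fun i _ => hterm i) (inv_nonneg.mpr hc0.le)
        _ = 16 * ρ := by rw [Finset.sum_const, Finset.card_univ, nsmul_eq_mul, ← mul_assoc, inv_mul_cancel₀ hc0.ne', one_mul]
    linarith [fl _ ha₈, fl _ hb₈, fl _ hc₈, fl _ hd₈]
  -- `(G ∘ φ) (0, K) = 0`: at zero member logarithms both terms equal `mlog K`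
  have hJ0 : ∀ K ∈ ball (1 : 𝔸) (8 * ρ), (G ∘ φ) (0, K) = 0 := fun K _ => by
    simp only [Function.comp_apply, hGdef, hφ, Prod.fst_zero, Prod.snd_zero, Pi.zero_apply, Finset.sum_const_zero, smul_zero, exp_zero, one_mul,
      mean_const, sub_self]
  -- the four points
  have hpi : ∀ (f : ι → 𝔸) (t : ℝ), 0 ≤ t → (∀ i, ‖f i‖ ≤ t) → ‖f‖ ≤ t := fun f t ht hf => (pi_norm_le_iff_of_nonneg ht).mpr hf
  have hexp : Real.exp ρ - 1 < 2 * ρ := by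
    have h := Real.exp_bound' (x := ρ) hρ0.le hρ1 (n := 2) (by norm_num)
    simp only [Finset.sum_range_succ, Finset.sum_range_zero, Nat.factorial, Nat.cast_ofNat] at h
    nlinarith
  have hxball : ∀ (f₁ f₂ f₃ f₄ : ι → 𝔸), (∀ i, ‖f₁ i‖ ≤ ρ) → (∀ i, ‖f₂ i‖ ≤ ρ) → (∀ i, ‖f₃ i‖ ≤ ρ) → (∀ i, ‖f₄ i‖ ≤ ρ) →
      ((f₁, f₂, f₃, f₄) : (ι → 𝔸) × (ι → 𝔸) × (ι → 𝔸) × (ι → 𝔸)) ∈ ball (0 : (ι → 𝔸) × (ι → 𝔸) × (ι → 𝔸) × (ι → 𝔸)) (8 * ρ / 2) :=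
    fun f₁ f₂ f₃ f₄ h₁ h₂ h₃ h₄ => by
    rw [mem_ball, dist_eq_norm, sub_zero]
    simp only [Prod.norm_def, max_lt_iff]
    refine ⟨?_, ?_, ?_, ?_⟩ <;> linarith [hpi _ _ hρ0.le h₁, hpi _ _ hρ0.le h₂, hpi _ _ hρ0.le h₃, hpi _ _ hρ0.le h₄]
  have hKball : ∀ (K : 𝔸), ‖K - 1‖ ≤ Real.exp ρ - 1 → K ∈ ball (1 : 𝔸) (8 * ρ / 2) := fun K hK => by
    rw [mem_ball, dist_eq_norm]; linarith
  have key := norm_sub_le_arcLinear hdiff hM hJ0 (hxball a b c d ha hb hc hd) (hxball a' b' c' d' ha' hb' hc' hd') (hKball H hH) (hKball H' hH')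
  -- sizes of the differences and of the background tuple
  have hdx : ‖((a', b', c', d') : (ι → 𝔸) × (ι → 𝔸) × (ι → 𝔸) × (ι → 𝔸)) - (a, b, c, d)‖ ≤ δ := by
    have hpi' : ∀ (f g : ι → 𝔸), (∀ i, ‖f i - g i‖ ≤ δ) → ‖f - g‖ ≤ δ := fun f g h =>
      (pi_norm_le_iff_of_nonneg hδ0).mpr fun i => by simpa using h i
    simp only [Prod.mk_sub_mk, Prod.norm_def, max_le_iff]
    exact ⟨hpi' _ _ hda, hpi' _ _ hdb, hpi' _ _ hdc, hpi' _ _ hdd⟩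
  have hx0 : ‖((a, b, c, d) : (ι → 𝔸) × (ι → 𝔸) × (ι → 𝔸) × (ι → 𝔸))‖ ≤ r₀ := by
    simp only [Prod.norm_def, max_le_iff]
    exact ⟨hpi _ _ hr₀ hra, hpi _ _ hr₀ hrb, hpi _ _ hr₀ hrc, hpi _ _ hr₀ hrd⟩
  have hE0 : 0 ≤ Real.exp (32 * ρ) - 1 := by linarith [Real.add_one_le_exp (32 * ρ)]
  have hδH0 : 0 ≤ δH := (norm_nonneg _).trans hdH
  have hc1 : 4 * (64 * (2 * (Real.exp (4 * (8 * ρ)) - 1)) * (64 * ρ)) / (8 * ρ) = 4096 * (Real.exp (32 * ρ) - 1) := by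
    rw [show 4 * (8 * ρ) = 32 * ρ by ring]; field_simp; ring
  have hc2 : ∀ s : ℝ, 16 * (64 * (2 * (Real.exp (4 * (8 * ρ)) - 1)) * (64 * ρ)) * s / (8 * ρ) ^ 2 = 2048 * (Real.exp (32 * ρ) - 1) / ρ * s := fun s => by
    rw [show 4 * (8 * ρ) = 32 * ρ by ring]; field_simp; ring
  rw [hc1, hc2] at key
  have hJ1 : (G ∘ φ) ((a', b', c', d'), H') = mlog (exp (((Fintype.card ι : ℝ))⁻¹ • ∑ i, a' i) * exp (((Fintype.card ι : ℝ))⁻¹ • ∑ i, b' i) *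
          exp (((Fintype.card ι : ℝ))⁻¹ • ∑ i, c' i) * exp (((Fintype.card ι : ℝ))⁻¹ • ∑ i, d' i) * H') -
        ((Fintype.card ι : ℝ))⁻¹ • ∑ i, ((Fintype.card ι : ℝ))⁻¹ • ∑ j, ((Fintype.card ι : ℝ))⁻¹ • ∑ k, ((Fintype.card ι : ℝ))⁻¹ • ∑ l,
          mlog (exp (a' i) * exp (b' j) * exp (c' k) * exp (d' l) * H') := rfl
  have hJ2 : (G ∘ φ) ((a, b, c, d), H) = mlog (exp (((Fintype.card ι : ℝ))⁻¹ • ∑ i, a i) * exp (((Fintype.card ι : ℝ))⁻¹ • ∑ i, b i) *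
          exp (((Fintype.card ι : ℝ))⁻¹ • ∑ i, c i) * exp (((Fintype.card ι : ℝ))⁻¹ • ∑ i, d i) * H) -
        ((Fintype.card ι : ℝ))⁻¹ • ∑ i, ((Fintype.card ι : ℝ))⁻¹ • ∑ j, ((Fintype.card ι : ℝ))⁻¹ • ∑ k, ((Fintype.card ι : ℝ))⁻¹ • ∑ l,
          mlog (exp (a i) * exp (b j) * exp (c k) * exp (d l) * H) := rfl
  rw [← hJ1, ← hJ2]
  refine key.trans (add_le_add ?_ ?_)
  · exact mul_le_mul_of_nonneg_left hdx (mul_nonneg (by norm_num) hE0)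
  · exact mul_le_mul (mul_le_mul_of_nonneg_left hx0 (div_nonneg (mul_nonneg (by norm_num) hE0) hρ0.le)) hdH (norm_nonneg _)
      (mul_nonneg (div_nonneg (mul_nonneg (by norm_num) hE0) hρ0.le) hr₀)

end Hybrid

/-! ## §3 The chain junk: `J₁₄(0, H) = 0` and the arc-linear letter -/

section Chain

variable {𝔸 : Type*} [NormedRing 𝔸] [NormedAlgebra ℂ 𝔸] [CompleteSpace 𝔸] [NormOneClass 𝔸]
variable {ι : Type*} [Fintype ι] [Nonempty ι]

/-- ★★★ **THE ARC-LINEAR RELATIVE CHAIN-COUPLING LETTER**: as ✓p823336 `norm_chain4_sub_chain4_le`, with the context difference `‖H′ − H‖ ≤ δ_H` priced by the size `r₀`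
of the UNPRIMED tuple: `‖J₁₄(p′) − J₁₄(p)‖ ≤ 4096·((e^{24ρ}−1)+(e^{16ρ}−1)+(e^{8ρ}−1))·δ + 2048·((e^{24ρ}−1)+(e^{16ρ}−1)+(e^{8ρ}−1))ρ⁻¹·r₀·δ_H`
(`J₁₄(0,0,0,0,·) ≡ 0`). [cite: Balaban1985Averaging, (26)-(27) p.22] -/
theorem norm_chain4_sub_chain4_le_arcLinear (a b c d a' b' c' d' : ι → 𝔸) (H H' : 𝔸) (σ₁ σ₂ σ₃ : Equiv.Perm ι) {ρ r₀ δ δH : ℝ} (hρ0 : 0 < ρ)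
    (hρ : ρ ≤ 1 / 800)
    (ha : ∀ i, ‖a i‖ ≤ ρ) (hb : ∀ i, ‖b i‖ ≤ ρ) (hc : ∀ i, ‖c i‖ ≤ ρ) (hd : ∀ i, ‖d i‖ ≤ ρ) (hH : ‖H - 1‖ ≤ Real.exp ρ - 1)
    (ha' : ∀ i, ‖a' i‖ ≤ ρ) (hb' : ∀ i, ‖b' i‖ ≤ ρ) (hc' : ∀ i, ‖c' i‖ ≤ ρ) (hd' : ∀ i, ‖d' i‖ ≤ ρ) (hH' : ‖H' - 1‖ ≤ Real.exp ρ - 1)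
    (hr₀ : 0 ≤ r₀) (hra : ∀ i, ‖a i‖ ≤ r₀) (hrb : ∀ i, ‖b i‖ ≤ r₀) (hrc : ∀ i, ‖c i‖ ≤ r₀) (hrd : ∀ i, ‖d i‖ ≤ r₀)
    (hδ0 : 0 ≤ δ) (hda : ∀ i, ‖a' i - a i‖ ≤ δ) (hdb : ∀ i, ‖b' i - b i‖ ≤ δ) (hdc : ∀ i, ‖c' i - c i‖ ≤ δ) (hdd : ∀ i, ‖d' i - d i‖ ≤ δ)
    (hdH : ‖H' - H‖ ≤ δH) :
    ‖(((Fintype.card ι : ℝ))⁻¹ • ∑ i, mlog (exp (a' i) * exp (b' (σ₁ i)) * exp (c' (σ₂ (σ₁ i))) * exp (d' (σ₃ (σ₂ (σ₁ i)))) * H') -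
        ((Fintype.card ι : ℝ))⁻¹ • ∑ i, ((Fintype.card ι : ℝ))⁻¹ • ∑ j, ((Fintype.card ι : ℝ))⁻¹ • ∑ k, ((Fintype.card ι : ℝ))⁻¹ • ∑ l,
          mlog (exp (a' i) * exp (b' j) * exp (c' k) * exp (d' l) * H')) -
      (((Fintype.card ι : ℝ))⁻¹ • ∑ i, mlog (exp (a i) * exp (b (σ₁ i)) * exp (c (σ₂ (σ₁ i))) * exp (d (σ₃ (σ₂ (σ₁ i)))) * H) -
        ((Fintype.card ι : ℝ))⁻¹ • ∑ i, ((Fintype.card ι : ℝ))⁻¹ • ∑ j, ((Fintype.card ι : ℝ))⁻¹ • ∑ k, ((Fintype.card ι : ℝ))⁻¹ • ∑ l,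
          mlog (exp (a i) * exp (b j) * exp (c k) * exp (d l) * H))‖ ≤
      4096 * ((Real.exp (24 * ρ) - 1) + (Real.exp (16 * ρ) - 1) + (Real.exp (8 * ρ) - 1)) * δ +
        2048 * ((Real.exp (24 * ρ) - 1) + (Real.exp (16 * ρ) - 1) + (Real.exp (8 * ρ) - 1)) / ρ * r₀ * δH := by
  set G : ((ι → 𝔸) × (ι → 𝔸) × (ι → 𝔸) × (ι → 𝔸) × 𝔸) → 𝔸 := fun p =>
      ((Fintype.card ι : ℝ))⁻¹ • ∑ i, mlog (exp (p.1 i) * exp (p.2.1 (σ₁ i)) * exp (p.2.2.1 (σ₂ (σ₁ i))) * exp (p.2.2.2.1 (σ₃ (σ₂ (σ₁ i)))) * p.2.2.2.2) -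
        ((Fintype.card ι : ℝ))⁻¹ • ∑ i, ((Fintype.card ι : ℝ))⁻¹ • ∑ j, ((Fintype.card ι : ℝ))⁻¹ • ∑ k, ((Fintype.card ι : ℝ))⁻¹ • ∑ l,
          mlog (exp (p.1 i) * exp (p.2.1 j) * exp (p.2.2.1 k) * exp (p.2.2.2.1 l) * p.2.2.2.2) with hGdef
  set φ : (((ι → 𝔸) × (ι → 𝔸) × (ι → 𝔸) × (ι → 𝔸)) × 𝔸) → ((ι → 𝔸) × (ι → 𝔸) × (ι → 𝔸) × (ι → 𝔸) × 𝔸) :=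
    fun q => (q.1.1, q.1.2.1, q.1.2.2.1, q.1.2.2.2, q.2) with hφ
  have hφd : Differentiable ℂ φ :=
    (differentiable_fst.comp differentiable_fst).prodMk ((differentiable_fst.comp (differentiable_snd.comp differentiable_fst)).prodMk
      ((differentiable_fst.comp (differentiable_snd.comp (differentiable_snd.comp differentiable_fst))).prodMk
        ((differentiable_snd.comp (differentiable_snd.comp (differentiable_snd.comp differentiable_fst))).prodMk differentiable_snd)))
  have hφmaps : ∀ {R : ℝ}, Set.MapsTo φ (ball (((0 : (ι → 𝔸) × (ι → 𝔸) × (ι → 𝔸) × (ι → 𝔸))), (1 : 𝔸)) R)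
      (ball ((0, 0, 0, 0, 1) : (ι → 𝔸) × (ι → 𝔸) × (ι → 𝔸) × (ι → 𝔸) × 𝔸) R) := fun {R} q hq => by
    simp only [hφ, mem_ball, Prod.dist_eq, Prod.fst_zero, Prod.snd_zero, max_lt_iff] at hq ⊢
    exact ⟨hq.1.1, hq.1.2.1, hq.1.2.2.1, hq.1.2.2.2, hq.2⟩
  have hρ1 : ρ ≤ 1 := by linarith
  have h0 : ∀ i, ‖(0 : ι → 𝔸) i‖ ≤ 0 := fun i => by simp
  have hdiffE : DifferentiableOn ℂ G (ball ((0, 0, 0, 0, 1) : (ι → 𝔸) × (ι → 𝔸) × (ι → 𝔸) × (ι → 𝔸) × 𝔸) (8 * ρ)) :=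
    differentiableOn_chain4 (p₀ := ((0, 0, 0, 0, 1) : (ι → 𝔸) × (ι → 𝔸) × (ι → 𝔸) × (ι → 𝔸) × 𝔸)) (ρ := 0) (r := 8 * ρ)
      (by linarith) (by linarith) h0 h0 h0 h0 (by simp) σ₁ σ₂ σ₃
  have hdiff := hdiffE.comp hφd.differentiableOn (hφmaps (R := 8 * ρ))
  have hM : ∀ q ∈ ball (((0 : (ι → 𝔸) × (ι → 𝔸) × (ι → 𝔸) × (ι → 𝔸))), (1 : 𝔸)) (8 * ρ),
      ‖(G ∘ φ) q‖ ≤ 1024 * (8 * ρ) * ((Real.exp (3 * (8 * ρ)) - 1) + (Real.exp (2 * (8 * ρ)) - 1) + (Real.exp (8 * ρ) - 1)) := by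
    intro q hq
    obtain ⟨ha₈, hb₈, hc₈, hd₈, hH₈⟩ := sizes_on_ball_one (hφmaps hq)
    rw [Function.comp_apply]
    exact norm_chain4_le_of_sizes (φ q).1 (φ q).2.1 (φ q).2.2.1 (φ q).2.2.2.1 (φ q).2.2.2.2 (by linarith) ha₈ hb₈ hc₈ hd₈ hH₈ σ₁ σ₂ σ₃
  have hJ0 : ∀ K ∈ ball (1 : 𝔸) (8 * ρ), (G ∘ φ) (0, K) = 0 := fun K _ => by
    simp only [Function.comp_apply, hGdef, hφ, Prod.fst_zero, Prod.snd_zero, Pi.zero_apply, exp_zero, one_mul, mean_const, sub_self]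
  have hpi : ∀ (f : ι → 𝔸) (t : ℝ), 0 ≤ t → (∀ i, ‖f i‖ ≤ t) → ‖f‖ ≤ t := fun f t ht hf => (pi_norm_le_iff_of_nonneg ht).mpr hf
  have hexp : Real.exp ρ - 1 < 2 * ρ := by
    have h := Real.exp_bound' (x := ρ) hρ0.le hρ1 (n := 2) (by norm_num)
    simp only [Finset.sum_range_succ, Finset.sum_range_zero, Nat.factorial, Nat.cast_ofNat] at h
    nlinarith
  have hxball : ∀ (f₁ f₂ f₃ f₄ : ι → 𝔸), (∀ i, ‖f₁ i‖ ≤ ρ) → (∀ i, ‖f₂ i‖ ≤ ρ) → (∀ i, ‖f₃ i‖ ≤ ρ) → (∀ i, ‖f₄ i‖ ≤ ρ) →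
      ((f₁, f₂, f₃, f₄) : (ι → 𝔸) × (ι → 𝔸) × (ι → 𝔸) × (ι → 𝔸)) ∈ ball (0 : (ι → 𝔸) × (ι → 𝔸) × (ι → 𝔸) × (ι → 𝔸)) (8 * ρ / 2) :=
    fun f₁ f₂ f₃ f₄ h₁ h₂ h₃ h₄ => by
    rw [mem_ball, dist_eq_norm, sub_zero]
    simp only [Prod.norm_def, max_lt_iff]
    refine ⟨?_, ?_, ?_, ?_⟩ <;> linarith [hpi _ _ hρ0.le h₁, hpi _ _ hρ0.le h₂, hpi _ _ hρ0.le h₃, hpi _ _ hρ0.le h₄]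
  have hKball : ∀ (K : 𝔸), ‖K - 1‖ ≤ Real.exp ρ - 1 → K ∈ ball (1 : 𝔸) (8 * ρ / 2) := fun K hK => by
    rw [mem_ball, dist_eq_norm]; linarith
  have key := norm_sub_le_arcLinear hdiff hM hJ0 (hxball a b c d ha hb hc hd) (hxball a' b' c' d' ha' hb' hc' hd') (hKball H hH) (hKball H' hH')
  have hdx : ‖((a', b', c', d') : (ι → 𝔸) × (ι → 𝔸) × (ι → 𝔸) × (ι → 𝔸)) - (a, b, c, d)‖ ≤ δ := by
    have hpi' : ∀ (f g : ι → 𝔸), (∀ i, ‖f i - g i‖ ≤ δ) → ‖f - g‖ ≤ δ := fun f g h =>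
      (pi_norm_le_iff_of_nonneg hδ0).mpr fun i => by simpa using h i
    simp only [Prod.mk_sub_mk, Prod.norm_def, max_le_iff]
    exact ⟨hpi' _ _ hda, hpi' _ _ hdb, hpi' _ _ hdc, hpi' _ _ hdd⟩
  have hx0 : ‖((a, b, c, d) : (ι → 𝔸) × (ι → 𝔸) × (ι → 𝔸) × (ι → 𝔸))‖ ≤ r₀ := by
    simp only [Prod.norm_def, max_le_iff]
    exact ⟨hpi _ _ hr₀ hra, hpi _ _ hr₀ hrb, hpi _ _ hr₀ hrc, hpi _ _ hr₀ hrd⟩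
  have e1 : 0 ≤ Real.exp (8 * ρ) - 1 := by linarith [Real.add_one_le_exp (8 * ρ)]
  have e2 : 0 ≤ Real.exp (16 * ρ) - 1 := by linarith [Real.add_one_le_exp (16 * ρ)]
  have e3 : 0 ≤ Real.exp (24 * ρ) - 1 := by linarith [Real.add_one_le_exp (24 * ρ)]
  have hS0 : 0 ≤ (Real.exp (24 * ρ) - 1) + (Real.exp (16 * ρ) - 1) + (Real.exp (8 * ρ) - 1) := by linarith
  have hc1 : 4 * (1024 * (8 * ρ) * ((Real.exp (3 * (8 * ρ)) - 1) + (Real.exp (2 * (8 * ρ)) - 1) + (Real.exp (8 * ρ) - 1))) / (8 * ρ) =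
      4096 * ((Real.exp (24 * ρ) - 1) + (Real.exp (16 * ρ) - 1) + (Real.exp (8 * ρ) - 1)) := by
    rw [show 3 * (8 * ρ) = 24 * ρ by ring, show 2 * (8 * ρ) = 16 * ρ by ring]; field_simp; ring
  have hc2 : ∀ s : ℝ, 16 * (1024 * (8 * ρ) * ((Real.exp (3 * (8 * ρ)) - 1) + (Real.exp (2 * (8 * ρ)) - 1) + (Real.exp (8 * ρ) - 1))) * s / (8 * ρ) ^ 2 =
      2048 * ((Real.exp (24 * ρ) - 1) + (Real.exp (16 * ρ) - 1) + (Real.exp (8 * ρ) - 1)) / ρ * s := fun s => by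
    rw [show 3 * (8 * ρ) = 24 * ρ by ring, show 2 * (8 * ρ) = 16 * ρ by ring]; field_simp; ring
  rw [hc1, hc2] at key
  have hJ1 : (G ∘ φ) ((a', b', c', d'), H') =
      ((Fintype.card ι : ℝ))⁻¹ • ∑ i, mlog (exp (a' i) * exp (b' (σ₁ i)) * exp (c' (σ₂ (σ₁ i))) * exp (d' (σ₃ (σ₂ (σ₁ i)))) * H') -
        ((Fintype.card ι : ℝ))⁻¹ • ∑ i, ((Fintype.card ι : ℝ))⁻¹ • ∑ j, ((Fintype.card ι : ℝ))⁻¹ • ∑ k, ((Fintype.card ι : ℝ))⁻¹ • ∑ l,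
          mlog (exp (a' i) * exp (b' j) * exp (c' k) * exp (d' l) * H') := rfl
  have hJ2 : (G ∘ φ) ((a, b, c, d), H) =
      ((Fintype.card ι : ℝ))⁻¹ • ∑ i, mlog (exp (a i) * exp (b (σ₁ i)) * exp (c (σ₂ (σ₁ i))) * exp (d (σ₃ (σ₂ (σ₁ i)))) * H) -
        ((Fintype.card ι : ℝ))⁻¹ • ∑ i, ((Fintype.card ι : ℝ))⁻¹ • ∑ j, ((Fintype.card ι : ℝ))⁻¹ • ∑ k, ((Fintype.card ι : ℝ))⁻¹ • ∑ l,
          mlog (exp (a i) * exp (b j) * exp (c k) * exp (d l) * H) := rfl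
  rw [← hJ1, ← hJ2]
  refine key.trans (add_le_add ?_ ?_)
  · exact mul_le_mul_of_nonneg_left hdx (mul_nonneg (by norm_num) hS0)
  · exact mul_le_mul (mul_le_mul_of_nonneg_left hx0 (div_nonneg (mul_nonneg (by norm_num) hS0) hρ0.le)) hdH (norm_nonneg _)
      (mul_nonneg (div_nonneg (mul_nonneg (by norm_num) hS0) hρ0.le) hr₀)

end Chain

end Summit.QuantumFields.YangMills.Theorems.FluctuationComparisonRegPrIntLS2BetaArcLinearCauchy

end
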